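import Mathlib.LinearAlgebra.Matrix.SchurComplement
import Literature.Computability.AlgebraicComplexity.GKKP11SymmetricRepresentations
import Literature.Computability.AlgebraicComplexity.SymmetricDetRepresentationProofs
import HarnessLib

/-!
# GKKP 2011, Theorem 2: a formula of skinny size `e` is a symmetric determinant of size `2e + 3`
— proof of the named fact `GKKP2011_thm2`

Topic `Literature/Computability/AlgebraicComplexity`; proofs file for
`GKKP11SymmetricRepresentations.lean` (B. Grenet, E. L. Kaltofen, P. Koiran, N. Portier, *Symmetric
determinantal representation of formulas and weakly skew circuits*, Contemp. Math. 556 (2011),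
arXiv:1007.3804; held text `paper:arxiv-1007.3804`). **Theorem 2** (§2.2, p0008:L14): "Let `φ` be
an arithmetic formula of skinny size `e`. Then there exists a matrix `A` of dimensions at most
`2e+3` whose entries are inputs of the formula and elements of `{0,1,-1,1/2}` such that
`φ = det A`" (symmetric: "The aim of this section is to write an arithmetic formula as a determinant
of a symmetric matrix", p0008), over a field of characteristic `≠ 2`.

## The proof (GKKP Lemma 3 and the proof of Thm. 2, p0008–p0010, in matrix form)

GKKP build an undirected graph `G` (`|G| ≤ 2e + 2`, vertices `s`, `t` and matched pairs) by
structural induction and then the graph `Ḡ = G + c` (edges `tc` of weight `1/2`, `cs` of weight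
`±1`) whose adjacency matrix is `A`; the determinant is evaluated by a bijection between cycle covers
and `s–t`-paths (properties (1)–(3) of Lemma 3). Here the same matrix is written in block form and
its determinant is computed by linear algebra, extending the tree's symmetrised-branching-program
calculus (`GKKP2011.symOfABP`, `det_symOfABP`, `borderBlock_mul_midInv_mul_transpose` of
`SymmetricDetRepresentationProofs.lean`, used there for Thm. 5) in two ways:

* the corner block gets the entry `m` at `(s, t)` — the direct edge `st` of GKKP's size-`0` graph
  (`φ = x`: "two vertices `s` and `t` and an edge `st` of weight `x`", p0009) — so the determinant
  becomes `(-1)^{|V|} · 2εη · (m − a·G·b)` (`GKKP2011.Thm2.det_symD`);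
* the links `u_in — u_out` of the middle block carry SIGNS `d u = ±1`: `[[0, D + Nᵀ], [D + N, 0]]`
  with `D = diagonal d` (`GKKP2011.Thm2.det_midBlockD`). The sign `−1` is GKKP's edge `t₁ s₂` of
  weight `−1` in the product construction (Fig. form-prod, p0009): the merged pair `t₁ ≡ s₂` is ONE
  new internal vertex with link `−1`.

`GKKP2011.Thm2.exists_signedABP` is Lemma 3 in this language: by induction on `φ`, internal
vertices `V` with `|V| = e` EXACTLY (leaf: `V = ∅`, `m = x` or `c`; sum: one new vertex `w` with
`s →[m₁] w`, link `+1`, `w →[−1] t`, i.e. GKKP's `u, v` of Fig. form-sum2 absorbing the direct edge of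
the first summand; product: one new vertex `w = (t₁ ≡ s₂)` with link `−1`, arcs `v →[b₁ v] w`,
`s →[m₁] w`, `w →[a₂ u] u`, `w →[m₂] t`), all entries inputs of `φ` or in `{0, ±1}`, transfer matrix
`D + N` block upper-triangular with determinant `±1`, and the value `m − a·y` (`(D + N) y = b`,
the signed path sum) equal to `φ` — for the product, `y = (φ₂ • y₁, −φ₂, y₂)` exhibits
`m − a·y = φ₁ φ₂`. The final matrix (`GKKP2011_thm2_holds`) takes `η = 1/2` on `tc` and
`ε = (-1)^e` on `cs`, exactly as printed ("edges `tc` of weight `1/2` and `cs` of weight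
`(-1)^{|G|/2-1}`", p0008), and is reindexed to `Fin (2e + 3)`.

No new definitions, no new facts. Honest framing: typed literature, rung V1 (symmetric-pencil
dictionary); nothing here bears on `VP ≠ VNP`.

## References

* [GrenetEtAl2011] B. Grenet, E. L. Kaltofen, P. Koiran, N. Portier, Contemp. Math. 556 (2011)
  61–96, arXiv:1007.3804: §2.2 Thm. 2 (p0008:L14), Lemma 3 and its proof (p0008–p0010), proof of
  Thm. 2 (p0008–p0009).
-/

noncomputable section

open Matrix MvPolynomial Finset

namespace Literature.Computability.AlgebraicComplexity

namespace GKKP2011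

namespace Thm2

variable {V : Type*} [Fintype V] [DecidableEq V] {R : Type*} [CommRing R]

/-- **Signed middle block.** For a diagonal sign matrix `D = diagonal d` and an adjacency matrix
`N` with `(D + N) G = 1` and `det (D + N)² = 1`, the block matrix `[[0, D + Nᵀ], [D + N, 0]]`
(GKKP's doubled internal vertices, the links `u_in — u_out` now carrying the signs `d u = ±1`)
has determinant `(-1)^{|V|}`. [cite: GrenetEtAl2011, Lemma 3 (proof)] -/
theorem det_midBlockD (d : V → R) (N G : Matrix V V R) (hG : (diagonal d + N) * G = 1)
    (hdet : (diagonal d + N).det ^ 2 = 1) :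
    (Matrix.fromBlocks 0 (diagonal d + Nᵀ) (diagonal d + N) 0).det = (-1) ^ Fintype.card V := by
  have hG' : G * (diagonal d + N) = 1 := mul_eq_one_comm.1 hG
  have hfac : Matrix.fromBlocks 0 (diagonal d + Nᵀ) (diagonal d + N) 0 =
      Matrix.fromBlocks 1 (-G) 0 1 *
        Matrix.fromBlocks 1 (diagonal d + Nᵀ) (diagonal d + N) (0 : Matrix V V R) := by
    rw [fromBlocks_multiply]
    simp only [Matrix.one_mul, Matrix.mul_zero, add_zero, Matrix.zero_mul, zero_add,
      Matrix.neg_mul, hG', add_neg_cancel]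
  have hT : diagonal d + Nᵀ = (diagonal d + N)ᵀ := by
    rw [transpose_add, diagonal_transpose]
  rw [hfac, det_mul, det_fromBlocks_zero₂₁, det_one, one_mul, one_mul, det_fromBlocks_one₁₁,
    zero_sub, ← neg_mul, det_mul, hT, det_transpose, ← neg_one_smul R (diagonal d + N), det_smul,
    Fintype.card, mul_assoc, ← sq, hdet, mul_one]

/-- **Determinant of the signed symmetrised branching program with a direct source–sink edge.**
With `D = diagonal d`, `(D + N) G = 1`, `det (D + N)² = 1`, the symmetric matrix
`[[C, B], [Bᵀ, M]]` — corner `C = [[0, ε, η], [ε, 0, m], [η, m, 0]]` on the vertices `c, s, t` (the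
`s–t` entry `m` is the direct edge of GKKP's size-`0` graph), border `B` = source arcs `a` into the
`in`-copies and sink arcs `b` out of the `out`-copies, middle block `M = [[0, D + Nᵀ], [D + N, 0]]` —
has determinant `(-1)^{|V|} · 2εη · (m − a·G·b)` (Schur complement; compare `det_symOfABP`).
[cite: GrenetEtAl2011, Thm 2 (proof)] -/
theorem det_symD (d : V → R) (N G : Matrix V V R) (hG : (diagonal d + N) * G = 1)
    (hdet : (diagonal d + N).det ^ 2 = 1) (a b : V → R) (ε η m : R) :
    (Matrix.fromBlocks !![0, ε, η; ε, 0, m; η, m, 0] (borderBlock a b) (borderBlock a b)ᵀ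
      (Matrix.fromBlocks 0 (diagonal d + Nᵀ) (diagonal d + N) 0)).det =
      (-1) ^ Fintype.card V * (2 * ε * η * (m - abpValue G a b)) := by
  have hG' : G * (diagonal d + N) = 1 := mul_eq_one_comm.1 hG
  have hT : (diagonal d + Nᵀ) * Gᵀ = 1 := by
    have h := congrArg transpose hG'
    rwa [transpose_mul, transpose_add, diagonal_transpose, transpose_one] at h
  have hinvD : Matrix.fromBlocks 0 (diagonal d + Nᵀ) (diagonal d + N) 0 * midInv G = 1 := by
    unfold midInv
    rw [fromBlocks_multiply]
    simp only [Matrix.zero_mul, Matrix.mul_zero, zero_add, add_zero, hG, hT, fromBlocks_one]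
  letI : Invertible (Matrix.fromBlocks 0 (diagonal d + Nᵀ) (diagonal d + N) (0 : Matrix V V R)) :=
    invertibleOfRightInverse _ _ hinvD
  have hinv : ⅟(Matrix.fromBlocks 0 (diagonal d + Nᵀ) (diagonal d + N) (0 : Matrix V V R)) =
      midInv G := invOf_eq_right_inv hinvD
  rw [det_fromBlocks₂₂, hinv, det_midBlockD d N G hG hdet, borderBlock_mul_midInv_mul_transpose,
    det_fin_three]
  simp
  ring

/-! ### The inductive construction (GKKP Lemma 3, in matrix form)

For a formula `φ` we build a *signed branching program with a direct edge*: internal vertices `V`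
(`|V| = e`, the skinny size), link signs `d : V → {±1}`, internal arcs `N`, source arcs `a`, sink
arcs `b`, direct `s–t` weight `m`, all entries inputs of `φ` or GKKP scalars, such that `D + N` is
unimodular (`det = ±1`, from acyclicity) and the *value* `m − a·y`, where `(D + N) y = b`, is `φ`.
Leaves: `V = ∅`, `m = x` (resp. `c`). Sum: disjoint union plus ONE new vertex `w` carrying the
direct edge of the first summand (`s →[m₁] w`, link `+1`, `w →[-1] t`) — GKKP's vertices `u, v`
(Fig. form-sum2). Product: disjoint union plus ONE new vertex `w = (t₁ ≡ s₂)` with link sign `−1`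
(GKKP's edge `t₁ s₂` of weight `−1`, Fig. form-prod): arcs `v →[b₁ v] w`, `s →[m₁] w`,
`w →[a₂ u] u`, `w →[m₂] t`. -/

section Construction

variable {k : Type} [Field k] {σ : Type}

/-- **GKKP Lemma 3 in matrix form**: every formula `φ` of skinny size `e` has a signed branching
program with a direct edge on exactly `e` internal vertices, with entries inputs of `φ` or in
`{0, 1, -1, 1/2}`, unimodular transfer matrix `D + N`, and value `φ`.
[cite: GrenetEtAl2011, Lemma 3] -/
theorem exists_signedABP (φ : ArithExpr k σ) :
    ∃ (V : Type) (_ : Fintype V) (_ : DecidableEq V) (d : V → MvPolynomial σ k)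
      (N : Matrix V V (MvPolynomial σ k)) (a b : V → MvPolynomial σ k) (m : MvPolynomial σ k),
      Fintype.card V = φ.size ∧
      (∀ v, d v = 1 ∨ d v = -1) ∧ (∀ v, N v v = 0) ∧
      (∀ u v, φ.IsInput (N u v) ∨ IsGKKPScalar (N u v)) ∧
      (∀ v, φ.IsInput (a v) ∨ IsGKKPScalar (a v)) ∧
      (∀ v, φ.IsInput (b v) ∨ IsGKKPScalar (b v)) ∧
      (φ.IsInput m ∨ IsGKKPScalar m) ∧
      ((diagonal d + N).det = 1 ∨ (diagonal d + N).det = -1) ∧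
      ∃ y : V → MvPolynomial σ k, (diagonal d + N) *ᵥ y = b ∧ m - a ⬝ᵥ y = φ.eval := by
  induction φ with
  | var i =>
    refine ⟨PEmpty, inferInstance, inferInstance, PEmpty.elim, Matrix.of fun v => v.elim,
      PEmpty.elim, PEmpty.elim, X i, by simp, fun v => v.elim, fun v => v.elim,
      fun v => v.elim, fun v => v.elim, fun v => v.elim, Or.inl rfl, Or.inl (det_isEmpty), ?_⟩
    exact ⟨PEmpty.elim, funext fun v => v.elim, by simp [dotProduct, ArithExpr.eval]⟩
  | const c =>
    refine ⟨PEmpty, inferInstance, inferInstance, PEmpty.elim, Matrix.of fun v => v.elim,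
      PEmpty.elim, PEmpty.elim, C c, by simp, fun v => v.elim, fun v => v.elim,
      fun v => v.elim, fun v => v.elim, fun v => v.elim, Or.inl rfl, Or.inl (det_isEmpty), ?_⟩
    exact ⟨PEmpty.elim, funext fun v => v.elim, by simp [dotProduct, ArithExpr.eval]⟩
  | add φ₁ φ₂ ih₁ ih₂ =>
    obtain ⟨V₁, _, _, d₁, N₁, a₁, b₁, m₁, hc₁, hd₁, hN₁0, hN₁, ha₁, hb₁, hm₁, hdet₁, y₁, hy₁, hv₁⟩ :=
      ih₁
    obtain ⟨V₂, _, _, d₂, N₂, a₂, b₂, m₂, hc₂, hd₂, hN₂0, hN₂, ha₂, hb₂, hm₂, hdet₂, y₂, hy₂, hv₂⟩ :=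
      ih₂
    -- the sum gadget on `V₁ ⊕ (Unit ⊕ V₂)`; the new vertex `w = inr (inl ())` absorbs `m₁`
    refine ⟨V₁ ⊕ (Unit ⊕ V₂), inferInstance, inferInstance,
      Sum.elim d₁ (Sum.elim (fun _ => 1) d₂),
      Matrix.fromBlocks N₁ 0 0 (Matrix.fromBlocks 0 0 0 N₂),
      Sum.elim a₁ (Sum.elim (fun _ => m₁) a₂),
      Sum.elim b₁ (Sum.elim (fun _ => -1) b₂), m₂, ?_, ?_, ?_, ?_, ?_, ?_, ?_, ?_, ?_⟩
    · simp only [Fintype.card_sum, Fintype.card_unique, hc₁, hc₂, ArithExpr.size_add]; omega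
    · rintro (v | ⟨⟨⟩ | v⟩)
      · exact hd₁ v
      · exact Or.inl rfl
      · exact hd₂ v
    · rintro (v | ⟨⟨⟩ | v⟩)
      · exact hN₁0 v
      · rfl
      · exact hN₂0 v
    · rintro (u | ⟨⟨⟩ | u⟩) (v | ⟨⟨⟩ | v⟩) <;>
        first
        | exact (hN₁ _ _).imp (fun h => Or.inl h) id
        | exact (hN₂ _ _).imp (fun h => Or.inr h) id
        | exact Or.inr (Or.inl rfl)
    · rintro (v | ⟨⟨⟩ | v⟩)
      · exact (ha₁ v).imp (fun h => Or.inl h) id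
      · exact hm₁.imp (fun h => Or.inl h) id
      · exact (ha₂ v).imp (fun h => Or.inr h) id
    · rintro (v | ⟨⟨⟩ | v⟩)
      · exact (hb₁ v).imp (fun h => Or.inl h) id
      · exact Or.inr (Or.inr (Or.inr (Or.inl rfl)))
      · exact (hb₂ v).imp (fun h => Or.inr h) id
    · exact hm₂.imp (fun h => Or.inr h) id
    · -- `det` of the block-diagonal transfer matrix
      have hD : diagonal (Sum.elim d₁ (Sum.elim (fun _ : Unit => (1 : MvPolynomial σ k)) d₂)) +
          Matrix.fromBlocks N₁ 0 0 (Matrix.fromBlocks 0 0 0 N₂) =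
          Matrix.fromBlocks (diagonal d₁ + N₁) 0 0
            (Matrix.fromBlocks (diagonal fun _ : Unit => (1 : MvPolynomial σ k)) 0 0
              (diagonal d₂ + N₂)) := by
        rw [← fromBlocks_diagonal, ← fromBlocks_diagonal, fromBlocks_add, fromBlocks_add]
        simp
      rw [hD, det_fromBlocks_zero₂₁, det_fromBlocks_zero₂₁, det_diagonal]
      simp only [Finset.univ_unique, Finset.prod_singleton, one_mul]
      rcases hdet₁ with h1 | h1 <;> rcases hdet₂ with h2 | h2 <;> rw [h1, h2] <;> simp
    · refine ⟨Sum.elim y₁ (Sum.elim (fun _ => -1) y₂), ?_, ?_⟩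
      · have hD : diagonal (Sum.elim d₁ (Sum.elim (fun _ : Unit => (1 : MvPolynomial σ k)) d₂)) +
            Matrix.fromBlocks N₁ 0 0 (Matrix.fromBlocks 0 0 0 N₂) =
            Matrix.fromBlocks (diagonal d₁ + N₁) 0 0
              (Matrix.fromBlocks (diagonal fun _ : Unit => (1 : MvPolynomial σ k)) 0 0
                (diagonal d₂ + N₂)) := by
          rw [← fromBlocks_diagonal, ← fromBlocks_diagonal, fromBlocks_add, fromBlocks_add]
          simp
        rw [hD, fromBlocks_mulVec, Sum.elim_comp_inl, Sum.elim_comp_inr, fromBlocks_mulVec,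
          Sum.elim_comp_inl, Sum.elim_comp_inr, hy₁, hy₂]
        simp only [Matrix.zero_mulVec, add_zero, zero_add]
        congr 1
        congr 1
        funext u
        simp [mulVec, dotProduct]
      · rw [sumElim_dotProduct_sumElim, sumElim_dotProduct_sumElim,
          ArithExpr.eval, ← hv₁, ← hv₂]
        simp [dotProduct]
        ring
  | mul φ₁ φ₂ ih₁ ih₂ =>
    obtain ⟨V₁, _, _, d₁, N₁, a₁, b₁, m₁, hc₁, hd₁, hN₁0, hN₁, ha₁, hb₁, hm₁, hdet₁, y₁, hy₁, hv₁⟩ :=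
      ih₁
    obtain ⟨V₂, _, _, d₂, N₂, a₂, b₂, m₂, hc₂, hd₂, hN₂0, hN₂, ha₂, hb₂, hm₂, hdet₂, y₂, hy₂, hv₂⟩ :=
      ih₂
    -- the product gadget on `V₁ ⊕ (Unit ⊕ V₂)`; the new vertex `w = inr (inl ())` is the merged
    -- pair `t₁ ≡ s₂` with link sign `-1`
    refine ⟨V₁ ⊕ (Unit ⊕ V₂), inferInstance, inferInstance,
      Sum.elim d₁ (Sum.elim (fun _ => -1) d₂),
      Matrix.fromBlocks N₁ (Matrix.of fun v j => Sum.elim (fun _ => b₁ v) (fun _ => 0) j) 0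
        (Matrix.fromBlocks 0 (Matrix.of fun _ u => a₂ u) 0 N₂),
      Sum.elim a₁ (Sum.elim (fun _ => m₁) 0),
      Sum.elim 0 (Sum.elim (fun _ => m₂) b₂), 0, ?_, ?_, ?_, ?_, ?_, ?_, ?_, ?_, ?_⟩
    · simp only [Fintype.card_sum, Fintype.card_unique, hc₁, hc₂, ArithExpr.size_mul]; omega
    · rintro (v | ⟨⟨⟩ | v⟩)
      · exact hd₁ v
      · exact Or.inr rfl
      · exact hd₂ v
    · rintro (v | ⟨⟨⟩ | v⟩)
      · exact hN₁0 v
      · rfl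
      · exact hN₂0 v
    · rintro (u | ⟨⟨⟩ | u⟩) (v | ⟨⟨⟩ | v⟩)
      · exact (hN₁ u v).imp (fun h => Or.inl h) id
      · exact (hb₁ u).imp (fun h => Or.inl h) id
      · exact Or.inr (Or.inl rfl)
      · exact Or.inr (Or.inl rfl)
      · exact Or.inr (Or.inl rfl)
      · exact (ha₂ v).imp (fun h => Or.inr h) id
      · exact Or.inr (Or.inl rfl)
      · exact Or.inr (Or.inl rfl)
      · exact (hN₂ u v).imp (fun h => Or.inr h) id
    · rintro (v | ⟨⟨⟩ | v⟩)
      · exact (ha₁ v).imp (fun h => Or.inl h) id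
      · exact hm₁.imp (fun h => Or.inl h) id
      · exact Or.inr (Or.inl rfl)
    · rintro (v | ⟨⟨⟩ | v⟩)
      · exact Or.inr (Or.inl rfl)
      · exact hm₂.imp (fun h => Or.inr h) id
      · exact (hb₂ v).imp (fun h => Or.inr h) id
    · exact Or.inr (Or.inl rfl)
    · -- `det` of the block upper-triangular transfer matrix
      have hD : diagonal (Sum.elim d₁ (Sum.elim (fun _ : Unit => (-1 : MvPolynomial σ k)) d₂)) +
          Matrix.fromBlocks N₁ (Matrix.of fun v j => Sum.elim (fun _ => b₁ v) (fun _ => 0) j) 0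
            (Matrix.fromBlocks 0 (Matrix.of fun _ u => a₂ u) 0 N₂) =
          Matrix.fromBlocks (diagonal d₁ + N₁)
            (Matrix.of fun v j => Sum.elim (fun _ => b₁ v) (fun _ => 0) j) 0
            (Matrix.fromBlocks (diagonal fun _ : Unit => (-1 : MvPolynomial σ k))
              (Matrix.of fun _ u => a₂ u) 0 (diagonal d₂ + N₂)) := by
        rw [← fromBlocks_diagonal, ← fromBlocks_diagonal, fromBlocks_add, fromBlocks_add]
        simp
      rw [hD, det_fromBlocks_zero₂₁, det_fromBlocks_zero₂₁, det_diagonal]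
      simp only [Finset.univ_unique, Finset.prod_singleton]
      rcases hdet₁ with h1 | h1 <;> rcases hdet₂ with h2 | h2 <;> rw [h1, h2] <;> simp
    · refine ⟨Sum.elim (φ₂.eval • y₁) (Sum.elim (fun _ => -φ₂.eval) y₂), ?_, ?_⟩
      · have hD : diagonal (Sum.elim d₁ (Sum.elim (fun _ : Unit => (-1 : MvPolynomial σ k)) d₂)) +
            Matrix.fromBlocks N₁ (Matrix.of fun v j => Sum.elim (fun _ => b₁ v) (fun _ => 0) j) 0
              (Matrix.fromBlocks 0 (Matrix.of fun _ u => a₂ u) 0 N₂) =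
            Matrix.fromBlocks (diagonal d₁ + N₁)
              (Matrix.of fun v j => Sum.elim (fun _ => b₁ v) (fun _ => 0) j) 0
              (Matrix.fromBlocks (diagonal fun _ : Unit => (-1 : MvPolynomial σ k))
                (Matrix.of fun _ u => a₂ u) 0 (diagonal d₂ + N₂)) := by
          rw [← fromBlocks_diagonal, ← fromBlocks_diagonal, fromBlocks_add, fromBlocks_add]
          simp
        have hm₂' : m₂ = φ₂.eval + a₂ ⬝ᵥ y₂ := by rw [← hv₂]; ring
        rw [hD, fromBlocks_mulVec, Sum.elim_comp_inl, Sum.elim_comp_inr, fromBlocks_mulVec,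
          Sum.elim_comp_inl, Sum.elim_comp_inr, Matrix.mulVec_smul, hy₁, hy₂]
        simp only [Matrix.zero_mulVec, zero_add]
        congr 1
        · funext v
          simp [mulVec, dotProduct, Fintype.sum_sum_type]
          ring
        · congr 1
          funext u
          simp [mulVec, dotProduct, hm₂']
      · rw [sumElim_dotProduct_sumElim, sumElim_dotProduct_sumElim,
          dotProduct_smul, ArithExpr.eval, ← hv₁, ← hv₂]
        simp [dotProduct]
        ring

end Construction

end Thm2

end GKKP2011

/-! ### The named fact -/

open GKKP2011 in
/-- **GKKP 2011, Theorem 2 — PROVED**: over a field of characteristic `≠ 2`, every arithmetic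
formula `φ` of skinny size `e` is the determinant of a SYMMETRIC matrix of size `2e + 3` whose
entries are inputs of `φ` or among `0, 1, -1, 1/2` — the adjacency matrix of GKKP's graph `Ḡ`,
here assembled as the block matrix of `GKKP2011.Thm2.det_symD` over the signed branching program of
`GKKP2011.Thm2.exists_signedABP` (`ε = (-1)^e`, `η = 1/2`). Discharges `GKKP2011_thm2`.
[cite: GrenetEtAl2011, Thm 2] -/
theorem GKKP2011_thm2_holds : GKKP2011_thm2 := by
  intro k _ h2 σ φ
  classical
  obtain ⟨V, _, _, d, N, a, b, m, hc, hd, hN0, hN, ha, hb, hm, hdet, y, hy, hv⟩ :=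
    Thm2.exists_signedABP φ
  -- the transfer matrix `T = D + N` is unimodular, `y = T⁻¹ b`
  set T : Matrix V V (MvPolynomial σ k) := diagonal d + N with hT
  have hdetsq : T.det ^ 2 = 1 := by
    rcases hdet with h | h <;> rw [h] <;> norm_num
  have hunit : IsUnit T.det := by
    rcases hdet with h | h <;> rw [h]
    · exact isUnit_one
    · exact isUnit_one.neg
  have hG : T * T⁻¹ = 1 := Matrix.mul_nonsing_inv T hunit
  have hG' : T⁻¹ * T = 1 := Matrix.nonsing_inv_mul T hunit
  have hyG : T⁻¹ *ᵥ b = y := by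
    rw [← hy, Matrix.mulVec_mulVec, hG', Matrix.one_mulVec]
  -- the scalars `ε = (-1)^{|V|}`, `η = 1/2`
  set ε : MvPolynomial σ k := (-1) ^ Fintype.card V with hε
  set η : MvPolynomial σ k := C (2⁻¹ : k) with hη
  have hεsq : ε * ε = 1 := by
    rw [hε, ← pow_add, ← two_mul, pow_mul, neg_one_sq, one_pow]
  have h2η : (2 : MvPolynomial σ k) * η = 1 := by
    rw [hη, show (2 : MvPolynomial σ k) = C 2 from (map_ofNat C 2).symm, ← C_mul,
      mul_inv_cancel₀ h2, C_1]
  have hεs : IsGKKPScalar ε := by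
    rcases neg_one_pow_eq_or (MvPolynomial σ k) (Fintype.card V) with h | h
    · exact Or.inr (Or.inl (hε.trans h))
    · exact Or.inr (Or.inr (Or.inl (hε.trans h)))
  have hηs : IsGKKPScalar η := Or.inr (Or.inr (Or.inr hη))
  have h0s : IsGKKPScalar (0 : MvPolynomial σ k) := Or.inl rfl
  -- the symmetric matrix on `c, s, t, V_in, V_out`
  set S : Matrix (Fin 3 ⊕ (V ⊕ V)) (Fin 3 ⊕ (V ⊕ V)) (MvPolynomial σ k) :=
    Matrix.fromBlocks !![0, ε, η; ε, 0, m; η, m, 0] (borderBlock a b) (borderBlock a b)ᵀ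
      (Matrix.fromBlocks 0 (diagonal d + Nᵀ) (diagonal d + N) 0) with hS
  have hdetS : S.det = φ.eval := by
    rw [hS, Thm2.det_symD d N T⁻¹ hG hdetsq a b ε η m, abpValue, hyG, hv]
    calc (-1) ^ Fintype.card V * (2 * ε * η * φ.eval)
        = ε * (ε * (2 * η) * φ.eval) := by rw [hε]; ring
      _ = φ.eval := by rw [h2η, mul_one, ← mul_assoc, hεsq, one_mul]
  have hSsym : S.IsSymm := by
    rw [hS]
    refine Matrix.IsSymm.fromBlocks ?_ rfl ?_
    · refine Matrix.IsSymm.ext fun i j => ?_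
      fin_cases i <;> fin_cases j <;> rfl
    · refine Matrix.IsSymm.fromBlocks (by simp [Matrix.IsSymm]) ?_ (by simp [Matrix.IsSymm])
      rw [transpose_add, diagonal_transpose, transpose_transpose]
  -- reindex to `Fin (2e + 3)`
  have hcard : Fintype.card (Fin 3 ⊕ (V ⊕ V)) = 2 * φ.size + 3 := by
    simp only [Fintype.card_sum, Fintype.card_fin, hc]
    ring
  let e := Fintype.equivFinOfCardEq hcard
  refine ⟨2 * φ.size + 3, le_rfl, Matrix.reindex e e S, hSsym.submatrix _, ?_, ?_⟩
  · -- entries: inputs of `φ` or GKKP scalars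
    intro i j
    rw [Matrix.reindex_apply, Matrix.submatrix_apply, hS]
    rcases e.symm i with p | (p | p) <;> rcases e.symm j with q | (q | q)
    · -- corner
      rw [Matrix.fromBlocks_apply₁₁]
      fin_cases p <;> fin_cases q <;>
        first
        | exact Or.inr h0s
        | exact Or.inr hεs
        | exact Or.inr hηs
        | exact hm
    · -- border, `in`-copies: source arcs
      rw [Matrix.fromBlocks_apply₁₂]
      fin_cases p
      · exact Or.inr h0s
      · exact ha q
      · exact Or.inr h0s
    · -- border, `out`-copies: sink arcs
      rw [Matrix.fromBlocks_apply₁₂]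
      fin_cases p
      · exact Or.inr h0s
      · exact Or.inr h0s
      · exact hb q
    · rw [Matrix.fromBlocks_apply₂₁, Matrix.transpose_apply]
      fin_cases q
      · exact Or.inr h0s
      · exact ha p
      · exact Or.inr h0s
    · rw [Matrix.fromBlocks_apply₂₂, Matrix.fromBlocks_apply₁₁]
      exact Or.inr h0s
    · rw [Matrix.fromBlocks_apply₂₂, Matrix.fromBlocks_apply₁₂, Matrix.add_apply,
        Matrix.transpose_apply, diagonal_apply]
      by_cases hpq : p = q
      · subst hpq
        rw [if_pos rfl, hN0, add_zero]
        rcases hd p with h | h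
        · exact Or.inr (Or.inr (Or.inl h))
        · exact Or.inr (Or.inr (Or.inr (Or.inl h)))
      · rw [if_neg hpq, zero_add]
        exact hN q p
    · rw [Matrix.fromBlocks_apply₂₁, Matrix.transpose_apply]
      fin_cases q
      · exact Or.inr h0s
      · exact Or.inr h0s
      · exact hb p
    · rw [Matrix.fromBlocks_apply₂₂, Matrix.fromBlocks_apply₂₁, Matrix.add_apply, diagonal_apply]
      by_cases hpq : p = q
      · subst hpq
        rw [if_pos rfl, hN0, add_zero]
        rcases hd p with h | h
        · exact Or.inr (Or.inr (Or.inl h))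
        · exact Or.inr (Or.inr (Or.inr (Or.inl h)))
      · rw [if_neg hpq, zero_add]
        exact hN p q
    · rw [Matrix.fromBlocks_apply₂₂, Matrix.fromBlocks_apply₂₂]
      exact Or.inr h0s
  · rw [Matrix.det_reindex_self, hdetS]

/-! ### Tree-vocabulary corollaries (unconditional forms of `GKKP2011_thm2.hasSymmDetRepr`) -/

/-- **Thm. 2 in tree vocabulary, PROVED**: over a field of characteristic `≠ 2`, the value of a
formula of skinny size `e` has a symmetric affine determinantal representation (`HasSymmDetRepr`) of
some size `≤ 2e + 3` (= `GKKP2011_thm2.hasSymmDetRepr` applied to `GKKP2011_thm2_holds`).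
[cite: GrenetEtAl2011, Thm 2] -/
theorem ArithExpr.exists_hasSymmDetRepr_eval (k : Type) [Field k] (h2 : (2 : k) ≠ 0) (σ : Type)
    (φ : ArithExpr k σ) : ∃ N ≤ 2 * φ.size + 3, HasSymmDetRepr φ.eval N :=
  GKKP2011_thm2.hasSymmDetRepr GKKP2011_thm2_holds k h2 σ φ

/-- **`sdc` of a formula**: over a field of characteristic `≠ 2`, the symmetric determinantal
complexity of the value of a formula of skinny size `e` is at most `2e + 3` (GKKP Thm. 2 with
`symmDeterminantalComplexity_le`). [cite: GrenetEtAl2011, Thm 2] -/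
theorem ArithExpr.symmDeterminantalComplexity_eval_le (k : Type) [Field k] (h2 : (2 : k) ≠ 0)
    (σ : Type) (φ : ArithExpr k σ) : symmDeterminantalComplexity φ.eval ≤ 2 * φ.size + 3 := by
  obtain ⟨N, hN, hrepr⟩ := ArithExpr.exists_hasSymmDetRepr_eval k h2 σ φ
  exact (symmDeterminantalComplexity_le hrepr).trans hN

end Literature.Computability.AlgebraicComplexity

end
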